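import Literature.NumberTheory.GaloisRepresentations.ContinuousShapiroLiftCores
import Literature.NumberTheory.GaloisRepresentations.LocalDualityTwoZero
import Literature.NumberTheory.GaloisRepresentations.TateDualityCounting
import Literature.NumberTheory.GaloisRepresentations.ContinuousCohomologyVanishing
import Summits.BirchSwinnertonDyer.Rank1Residual.GaloisImage.LocalEulerPoincareCharacteristicHolds
import Literature.NumberTheory.EllipticCurves.LocalEulerCharacteristicTorsion
import HarnessLib

/-!
# Two-sided count of `H¹(N, M)` for an open normal subgroup `N ≤ Γ_F` of a `p`-adic field, by Shapiro to the base
# and Tate's local Euler–Poincaré characteristic (crux ♭T≤ stmt-BirchSwinnertonDyer-23042, line `sigmacongruence`,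
# stub TS1′ `stub_twinStrictSurj`, brick (1c±)(d) of the growth road)

Route `UniversalToricDescent`, lead prover `bsd-wall-utd-p1` g17. THEOREMS ONLY (no definition, no named fact, no `sorry`);
`--supports stmt-BirchSwinnertonDyer-23042`. BSD is not proved by any of this.

For a non-archimedean local field `F` of characteristic `0`, a finite discrete `Γ_F`-module `M` killed by `p^k`, and an
OPEN NORMAL subgroup `N ≤ Γ_F` (on the route: the `n`-th layer of the local anticyclotomic `ℤ₃`-tower at the strict place),
the finite coinduced module `C = Maps(Γ_F ⧸ N, M)` (`coindFin`, diagonal action) satisfies Shapiro `H¹(N, M) ≅ H¹(Γ_F, C)`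
(tree `shapiroLift`), and Tate's formula `#C^Γ · #H²(F, C) · #(𝒪_F/#C) = #H¹(F, C)` (tree THEOREM
`localEulerPoincareCharacteristic_holds`) gives

  `#(𝒪_F / (#M)^{[Γ_F:N]}) ≤ #H¹(N, M) ≤ #M^N · #Hom_N(M, μ_{p^k}) · #(𝒪_F / (#M)^{[Γ_F:N]})`

— the LOWER bound needs nothing else; the UPPER bound uses two INJECTIONS (no isomorphism is needed): `C^{Γ_F} ↪ M^N`
(evaluation at the unit coset, §1) and, after local duality in bidegree `(2,0)` (`#H²(F, C) = #Hom_{Γ_F}(C, μ)`, tree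
`natCard_two_eq_natCard_invariants_homRep`), Frobenius reciprocity `Hom_{Γ_F}(C, μ) ↪ Hom_N(M, μ)`, `Φ ↦ Φ ∘ δ_{1̄}` (§2).
The coinduced representation is consumed through a CHARACTERISATION hypothesis `hρC : ρC g φ y = ρ g (φ (g⁻¹ y))` (any
`ContinuousRep` structure on `Maps(Γ ⧸ N, M)` with this action), so that no definitional unfolding of `coindFin` is ever needed.

* §1 `natCard_invariants_coind_le` — `#C^Γ ≤ #M^N`;
* §2 `natCard_invariants_homRep_coind_le` — `#Hom_Γ(C, Ω) ≤ #Hom_N(M, Ω)`;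
* §3 `natCard_H1_subgroup_bounds` — the displayed two-sided count (with finiteness of `H¹(N, M)`).

References: [NeukirchSchmidtWingberg2008] I §6 Prop. (1.6.4) (Shapiro), (1.6.?) Frobenius reciprocity; [MilneADT2006] I Cor. 2.3,
Thm. 2.8; [SerreGaloisCohomology1997] II §5.2, §5.7; [GreenbergVatsal2000] §2 Prop. (2.1) (the local terms at `p`).
-/

set_option autoImplicit false
-- the Theorems namespace of this sub repeats the summit name by design (D-0017 nested layout)
set_option linter.dupNamespace false

noncomputable section

open scoped Classical ValuativeRel
open CategoryTheory Function
open Literature.NumberTheory.GaloisRepresentations Literature.NumberTheory.GaloisRepresentations.DiscreteGaloisModule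

universe u

namespace Summit.BirchSwinnertonDyer.BirchSwinnertonDyer.Theorems.UniversalToricDescentLocalShapiroCount

/-! ### §1 Invariants of the coinduced module inject into `M^N` -/

section Generic

variable {G : Type u} [Group G] [TopologicalSpace G] [IsTopologicalGroup G]
variable {M : Type u} [AddCommGroup M] [TopologicalSpace M] [DiscreteTopology M]
variable (ρ : ContinuousRep G ℤ M) (N : Subgroup G)
variable (ρC : ContinuousRep G ℤ (G ⧸ N → M)) (hρC : ∀ (g : G) (φ : G ⧸ N → M) (y : G ⧸ N), ρC g φ y = ρ g (φ (g⁻¹ • y)))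

include hρC

omit [IsTopologicalGroup G] in
/-- A `G`-invariant `φ ∈ Maps(G ⧸ N, M)` satisfies `φ(gN) = g · φ(N)`. [cite: NeukirchSchmidtWingberg2008, I §6 (induced modules)] -/
theorem apply_coe_eq_of_mem_invariants (φ : G ⧸ N → M) (hφ : φ ∈ ρC.toTopRep.ρ.invariants) (g : G) :
    φ (g : G ⧸ N) = ρ g (φ ((1 : G) : G ⧸ N)) := by
  have h := congrFun (hφ g) (g : G ⧸ N)
  rw [ContinuousRep.toContRepresentation_apply_apply, hρC] at h
  rw [← h, MulAction.Quotient.smul_coe, smul_eq_mul, inv_mul_cancel]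

omit [IsTopologicalGroup G] in
/-- The value at the unit coset of a `G`-invariant `φ ∈ Maps(G ⧸ N, M)` is `N`-invariant.
[cite: NeukirchSchmidtWingberg2008, I §6 (induced modules)] -/
theorem apply_one_mem_of_mem_invariants (φ : G ⧸ N → M) (hφ : φ ∈ ρC.toTopRep.ρ.invariants)
    (n : G) (hn : n ∈ N) : ρ n (φ ((1 : G) : G ⧸ N)) = φ ((1 : G) : G ⧸ N) := by
  rw [← apply_coe_eq_of_mem_invariants ρ N ρC hρC φ hφ n]
  congr 1
  rw [QuotientGroup.eq, mul_one]
  exact N.inv_mem hn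

omit [IsTopologicalGroup G] in
/-- **`#Maps(G ⧸ N, M)^G ≤ #M^N`**: evaluation at the unit coset is injective on invariants (`φ(gN) = g · φ(N)`).
[cite: NeukirchSchmidtWingberg2008, I §6 Prop. (1.6.4) (degree `0`)] -/
theorem natCard_invariants_coind_le [Finite M] :
    Nat.card ρC.toTopRep.ρ.invariants ≤ Nat.card {m : M // ∀ n : G, n ∈ N → ρ n m = m} := by
  refine Nat.card_le_card_of_injective
    (fun φ ↦ ⟨(φ : G ⧸ N → M) ((1 : G) : G ⧸ N), apply_one_mem_of_mem_invariants ρ N ρC hρC φ.1 φ.2⟩)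
    fun φ ψ h ↦ ?_
  have h1 : (φ : G ⧸ N → M) ((1 : G) : G ⧸ N) = (ψ : G ⧸ N → M) ((1 : G) : G ⧸ N) := congrArg Subtype.val h
  apply Subtype.ext
  funext y
  obtain ⟨g, rfl⟩ := QuotientGroup.mk_surjective y
  rw [apply_coe_eq_of_mem_invariants ρ N ρC hρC φ.1 φ.2, apply_coe_eq_of_mem_invariants ρ N ρC hρC ψ.1 ψ.2, h1]

/-! ### §2 Frobenius reciprocity as an injection `Hom_G(Maps(G ⧸ N, M), Ω) ↪ Hom_N(M, Ω)` -/

variable {Ω : Type u} [AddCommGroup Ω] [TopologicalSpace Ω] [DiscreteTopology Ω] (ω : ContinuousRep G ℤ Ω)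

omit [IsTopologicalGroup G] [DiscreteTopology M] in
/-- The action on a function supported at the unit coset: `g ⋆ δ_{1̄}(x) = δ_{gN}(g x)`. [cite: SerreLocalFields1979, VII §6] -/
theorem apply_single_one (g : G) (x : M) :
    ρC g (Pi.single ((1 : G) : G ⧸ N) x) = Pi.single (g : G ⧸ N) (ρ g x) := by
  funext y
  rw [hρC]
  by_cases hy : y = (g : G ⧸ N)
  · rw [hy, Pi.single_eq_same, MulAction.Quotient.smul_coe, smul_eq_mul, inv_mul_cancel, Pi.single_eq_same]
  · have hy' : g⁻¹ • y ≠ ((1 : G) : G ⧸ N) := by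
      intro h
      apply hy
      rw [inv_smul_eq_iff, MulAction.Quotient.smul_coe, smul_eq_mul, mul_one] at h
      exact h
    rw [Pi.single_eq_of_ne hy, Pi.single_eq_of_ne hy', map_zero]

variable [Finite M]

/-- **Frobenius reciprocity, injective half: `#Hom_G(Maps(G ⧸ N, M), Ω) ≤ #Hom_N(M, Ω)`** via `Φ ↦ Φ ∘ δ_{1̄}` (an equivariant
`Φ` is determined by its values on the `δ_{gN}(x) = g ⋆ δ_{1̄}(g⁻¹ x)`, which span). [cite: NeukirchSchmidtWingberg2008, I §6 (Frobenius reciprocity)] -/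
theorem natCard_invariants_homRep_coind_le [Finite Ω] [Finite (G ⧸ N)] :
    Nat.card (ρC.homRep ω).toTopRep.ρ.invariants ≤
      Nat.card {h : HomCarrier M Ω // ∀ n : G, n ∈ N → ∀ m : M, ω n (h m) = h (ρ n m)} := by
  haveI : Finite (HomCarrier M Ω) := Finite.of_injective (fun h : HomCarrier M Ω ↦ (h : M → Ω)) DFunLike.coe_injective
  -- the restriction `Φ ↦ Φ ∘ δ_{1̄}`
  let δ : M →+ (G ⧸ N → M) := AddMonoidHom.single (fun _ : G ⧸ N ↦ M) ((1 : G) : G ⧸ N)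
  have hδ : ∀ x : M, δ x = Pi.single ((1 : G) : G ⧸ N) x := fun _ ↦ rfl
  have hequiv : ∀ Φ : HomCarrier (G ⧸ N → M) Ω, Φ ∈ (ρC.homRep ω).toTopRep.ρ.invariants →
      ∀ (g : G) (φ : G ⧸ N → M), ω g (Φ φ) = Φ (ρC g φ) := fun Φ hΦ g ↦
    (ContinuousRep.homRep_apply_eq_self_iff ρC ω g Φ).mp (hΦ g)
  refine Nat.card_le_card_of_injective
    (fun Φ ↦ ⟨((Φ : HomCarrier (G ⧸ N → M) Ω) : (G ⧸ N → M) →+ Ω).comp δ, fun n hn m ↦ ?_⟩) fun Φ Ψ h ↦ ?_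
  · -- `N`-equivariance of `Φ ∘ δ_{1̄}`
    have hn1 : (n : G ⧸ N) = ((1 : G) : G ⧸ N) := QuotientGroup.eq.mpr (by rw [mul_one]; exact N.inv_mem hn)
    change ω n (Φ.1 (δ m)) = Φ.1 (δ (ρ n m))
    rw [hequiv Φ.1 Φ.2 n, hδ, hδ, apply_single_one ρ N ρC hρC, hn1]
  · -- injectivity: `Φ` is determined on the `δ_{gN}(x)`
    have h1 : ∀ x : M, Φ.1 (δ x) = Ψ.1 (δ x) := fun x ↦ by
      have := congrArg (fun f : {h : HomCarrier M Ω // ∀ n : G, n ∈ N → ∀ m : M, ω n (h m) = h (ρ n m)} ↦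
        (f.1 : M → Ω) x) h
      exact this
    apply Subtype.ext
    refine HomCarrier.ext fun φ ↦ ?_
    refine Pi.single_induction (fun φ : G ⧸ N → M ↦ Φ.1 φ = Ψ.1 φ) φ ?_ ?_ ?_
    · rw [map_zero, map_zero]
    · intro f g hf hg
      rw [map_add, map_add, hf, hg]
    · intro y x
      obtain ⟨g, rfl⟩ := QuotientGroup.mk_surjective y
      have e : Pi.single (g : G ⧸ N) x = ρC g (Pi.single ((1 : G) : G ⧸ N) (ρ g⁻¹ x)) := by
        rw [apply_single_one ρ N ρC hρC, ← Module.End.mul_apply, ← map_mul, mul_inv_cancel, map_one,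
          Module.End.one_apply]
      rw [e, ← hequiv Φ.1 Φ.2, ← hequiv Ψ.1 Ψ.2, ← hδ, h1]

omit hρC [Finite M] in
/-- **The coinduced action on `Maps(G ⧸ N, M)` is jointly continuous** for `N` open normal and `M` discrete: the stabiliser of `φ`
contains `N ∩ ⋂_y Stab_ρ(φ y)` (`N` acts trivially on `G ⧸ N`). So a `ContinuousRep` structure with the action
`(g ⋆ φ)(y) = g · φ(g⁻¹ y)` exists. [cite: SerreLocalFields1979, VII §6] [cite: NeukirchSchmidtWingberg2008, I §6] -/
theorem exists_continuousRep_coind (hN : IsOpen (N : Set G)) [N.Normal] [Finite (G ⧸ N)] :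
    ∃ ρC : ContinuousRep G ℤ (G ⧸ N → M), ∀ (g : G) (φ : G ⧸ N → M) (y : G ⧸ N), ρC g φ y = ρ g (φ (g⁻¹ • y)) := by
  refine ⟨ContinuousRep.ofStabilizerMemNhdsOne (coindFin ρ.toTopRep N).ρ.toRepresentation fun φ ↦ ?_, fun _ _ _ ↦ rfl⟩
  have h : ∀ y : G ⧸ N, ∀ᶠ g in nhds (1 : G), ρ g (φ y) = φ y := fun y ↦ ρ.setOf_apply_eq_mem_nhds_one (φ y)
  have hN1 : ∀ᶠ g in nhds (1 : G), g ∈ N := hN.mem_nhds N.one_mem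
  filter_upwards [Filter.eventually_all.2 h, hN1] with g hg hgN
  funext y
  change ρ g (φ (g⁻¹ • y)) = φ y
  have hy : g⁻¹ • y = y := by
    obtain ⟨x, rfl⟩ := QuotientGroup.mk_surjective y
    rw [MulAction.Quotient.smul_coe, smul_eq_mul, QuotientGroup.eq, mul_inv_rev, inv_inv]
    exact Subgroup.Normal.conj_mem' inferInstance g hgN x
  rw [hy, hg y]

end Generic

/-! ### §3 The two-sided count over a `p`-adic field -/

section Local

variable (F : Type u) [Field F] [ValuativeRel F] [TopologicalSpace F] [IsNonarchimedeanLocalField F] [CharZero F]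
variable {M : Type u} [AddCommGroup M] [TopologicalSpace M] [DiscreteTopology M] [Finite M]

/-- **`#(𝒪_F/(#M)^{[Γ:N]}) ≤ #H¹(N, M) ≤ #M^N · #Hom_N(M, μ_{p^k}) · #(𝒪_F/(#M)^{[Γ:N]})`** for an open normal `N ≤ Γ_F` and a
finite discrete `Γ_F`-module `M` killed by `p^k` (Shapiro to the base + Tate's local Euler–Poincaré characteristic + §1, §2 +
local duality in bidegree `(2,0)`); `H¹(N, M)` is finite. See the module docstring.
[cite: MilneADT2006, I Thm. 2.8, Cor. 2.3] [cite: NeukirchSchmidtWingberg2008, I §6 Prop. (1.6.4)] -/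
theorem natCard_H1_subgroup_bounds {p k : ℕ} [Fact p.Prime] (ρ : ContinuousRep (Field.absoluteGaloisGroup F) ℤ M)
    (hM : ∀ m : M, p ^ k • m = 0) (N : Subgroup (Field.absoluteGaloisGroup F))
    (hN : IsOpen (N : Set (Field.absoluteGaloisGroup F))) [N.Normal]
    (ρC : ContinuousRep (Field.absoluteGaloisGroup F) ℤ (Field.absoluteGaloisGroup F ⧸ N → M))
    (hρC : ∀ (g : Field.absoluteGaloisGroup F) (φ : Field.absoluteGaloisGroup F ⧸ N → M)
      (y : Field.absoluteGaloisGroup F ⧸ N), ρC g φ y = ρ g (φ (g⁻¹ • y))) :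
    Finite (continuousCohomology 1 (subgroupRep ρ.toTopRep N)) ∧
    Nat.card (𝒪[F] ⧸ Ideal.span {((Nat.card M ^ Nat.card (Field.absoluteGaloisGroup F ⧸ N) : ℕ) : 𝒪[F])}) ≤
      Nat.card (continuousCohomology 1 (subgroupRep ρ.toTopRep N)) ∧
    Nat.card (continuousCohomology 1 (subgroupRep ρ.toTopRep N)) ≤
      Nat.card {m : M // ∀ n : Field.absoluteGaloisGroup F, n ∈ N → ρ n m = m} *
        Nat.card {h : HomCarrier M (MuCarrier F (p ^ k)) //
          ∀ n : Field.absoluteGaloisGroup F, n ∈ N → ∀ m : M, mu F (p ^ k) n (h m) = h (ρ n m)} *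
        Nat.card (𝒪[F] ⧸ Ideal.span {((Nat.card M ^ Nat.card (Field.absoluteGaloisGroup F ⧸ N) : ℕ) : 𝒪[F])}) := by
  -- `H²` needs `LocallyCompactSpace Γ_F`: compactness of the absolute Galois group as a local instance (in-proof)
  haveI : CompactSpace (Field.absoluteGaloisGroup F) := absoluteGaloisGroup_compactSpace F
  haveI : NeZero (p ^ k) := ⟨pow_ne_zero k (Fact.out : p.Prime).ne_zero⟩
  haveI : Finite (MuCarrier F (p ^ k)) := finite_muCarrier F (p ^ k)
  haveI hfinQ : Finite (Field.absoluteGaloisGroup F ⧸ N) := Subgroup.quotient_finite_of_isOpen N hN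
  -- coset representatives with `s(1̄) = 1`
  let s : Field.absoluteGaloisGroup F ⧸ N → Field.absoluteGaloisGroup F := fun y ↦
    if y = ((1 : Field.absoluteGaloisGroup F) : Field.absoluteGaloisGroup F ⧸ N) then 1 else Quotient.out y
  have hs : ∀ y, (s y : Field.absoluteGaloisGroup F ⧸ N) = y := fun y ↦ by
    by_cases hy : y = ((1 : Field.absoluteGaloisGroup F) : Field.absoluteGaloisGroup F ⧸ N)
    · subst hy
      simp only [s, ↓reduceIte]
    · simp only [s, if_neg hy]
      exact QuotientGroup.out_eq' y
  have hs1 : s ((1 : Field.absoluteGaloisGroup F) : Field.absoluteGaloisGroup F ⧸ N) = 1 := by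
    simp only [s, if_pos rfl]
  -- Shapiro: `H¹(N, M) ≅ H¹(Γ_F, C)`
  have hSh : Nat.card (continuousCohomology 1 (subgroupRep ρ.toTopRep N)) =
      Nat.card (continuousCohomology 1 (coindFin ρ.toTopRep N)) :=
    Nat.card_eq_of_bijective _ ⟨shapiroLift_injective ρ.toTopRep N hN hs hs1, shapiroLift_surjective ρ.toTopRep N hN hs hs1⟩
  -- the coinduced representation `ρC` IS `coindFin ρ N`
  let e : ρC.toTopRep ≅ coindFin ρ.toTopRep N :=
    topRepIsoOfEquiv (X := ρC.toTopRep) (Y := coindFin ρ.toTopRep N) (ContinuousLinearEquiv.refl ℤ _) fun g φ ↦ by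
      funext y
      exact hρC g φ y
  have hC1 : Nat.card (continuousCohomology 1 ρC.toTopRep) = Nat.card (continuousCohomology 1 (coindFin ρ.toTopRep N)) :=
    natCard_continuousCohomology_eq_of_iso e 1
  -- Tate's local Euler–Poincaré characteristic for `C`
  obtain ⟨h1fin, h2fin, hEP⟩ := localEulerPoincareCharacteristic_holds F ρC
  have hcardC : Nat.card (Field.absoluteGaloisGroup F ⧸ N → M) = Nat.card M ^ Nat.card (Field.absoluteGaloisGroup F ⧸ N) :=
    Nat.card_fun
  rw [hcardC] at hEP
  -- finiteness of `H¹(N, M)`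
  have hfin1 : Finite (continuousCohomology 1 (subgroupRep ρ.toTopRep N)) := by
    haveI := h1fin
    haveI : Finite (continuousCohomology 1 (coindFin ρ.toTopRep N)) := Finite.of_equiv _ (continuousCohomologyEquivOfIso e 1)
    exact Finite.of_injective _ (shapiroLift_injective ρ.toTopRep N hN hs hs1)
  -- positivity of the factors
  haveI : Finite ρC.toTopRep.ρ.invariants := Finite.of_injective _ Subtype.val_injective
  have h0pos : 0 < Nat.card ρC.toTopRep.ρ.invariants := Nat.card_pos
  haveI := h2fin
  have h2pos : 0 < Nat.card (continuousCohomology 2 ρC.toTopRep) := Nat.card_pos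
  refine ⟨hfin1, ?_, ?_⟩
  · -- lower bound
    rw [hSh, ← hC1, ← hEP]
    calc _ = 1 * 1 * Nat.card (𝒪[F] ⧸ Ideal.span {((Nat.card M ^ Nat.card (Field.absoluteGaloisGroup F ⧸ N) : ℕ) : 𝒪[F])}) := by
          rw [one_mul, one_mul]
      _ ≤ _ := Nat.mul_le_mul_right _ (Nat.mul_le_mul h0pos h2pos)
  · -- upper bound: `#C^Γ ≤ #M^N` (§1) and `#H²(F, C) = #Hom_Γ(C, μ) ≤ #Hom_N(M, μ)` ((2,0) + §2)
    have hCtors : ∀ φ : Field.absoluteGaloisGroup F ⧸ N → M, p ^ k • φ = 0 := fun φ ↦ funext fun y ↦ by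
      rw [Pi.smul_apply, Pi.zero_apply, hM]
    obtain ⟨-, h2eq⟩ := natCard_two_eq_natCard_invariants_homRep F ρC hCtors
    rw [hSh, ← hC1, ← hEP, h2eq]
    exact Nat.mul_le_mul_right _ (Nat.mul_le_mul (natCard_invariants_coind_le ρ N ρC hρC)
      (natCard_invariants_homRep_coind_le ρ N ρC hρC (mu F (p ^ k))))

end Local

/-! ### §4 The case `M = E[n]`: `#Hom_N(E[n], μ_n) = #E[n]^N` (Weil) and the count for an elliptic curve -/

section Weil

/-- Fixed vectors of a subgroup correspond under an isomorphism of topological `Γ`-modules. [folklore] -/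
theorem natCard_fixed_eq_of_iso {Γ : Type u} [Group Γ] [TopologicalSpace Γ] [IsTopologicalGroup Γ]
    {V₁ : Type u} [AddCommGroup V₁] [TopologicalSpace V₁] [DiscreteTopology V₁]
    {V₂ : Type u} [AddCommGroup V₂] [TopologicalSpace V₂] [DiscreteTopology V₂]
    {τ₁ : ContinuousRep Γ ℤ V₁} {τ₂ : ContinuousRep Γ ℤ V₂} (e : τ₁.toTopRep ≅ τ₂.toTopRep) (N : Subgroup Γ) :
    Nat.card {v : V₁ // ∀ g : Γ, g ∈ N → τ₁ g v = v} = Nat.card {w : V₂ // ∀ g : Γ, g ∈ N → τ₂ g w = w} := by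
  refine Nat.card_congr
    { toFun := fun v ↦ ⟨e.hom.hom v.1, fun g hg ↦ by rw [← ContinuousRep.hom_comm_apply e.hom g, v.2 g hg]⟩
      invFun := fun w ↦ ⟨e.inv.hom w.1, fun g hg ↦ by rw [← ContinuousRep.hom_comm_apply e.inv g, w.2 g hg]⟩
      left_inv := fun v ↦ Subtype.ext (by
        change e.inv.hom (e.hom.hom v.1) = v.1
        rw [← TopRep.comp_apply, e.hom_inv_id, TopRep.id_apply])
      right_inv := fun w ↦ Subtype.ext (by
        change e.hom.hom (e.inv.hom w.1) = w.1
        rw [← TopRep.comp_apply, e.inv_hom_id, TopRep.id_apply]) }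

variable {K : Type u} [Field K] [NumberField K] (W : WeierstrassCurve K) [W.IsElliptic]
variable (F : Type u) [Field F] [Algebra K F] [CharZero F] [ValuativeRel F] [TopologicalSpace F] [IsNonarchimedeanLocalField F]

omit [ValuativeRel F] [TopologicalSpace F] [IsNonarchimedeanLocalField F] in
/-- **`#Hom_N(E[n], μ_n) = #E[n]^N`** for every subgroup `N ≤ Γ_F` (`F ⊇ K` a `p`-adic field, `n` a prime power): the Weil pairing
`E[n] ≅ Hom(E[n], μ_n)` is `Γ_F`-equivariant (tree `weilDualLocalIso`), and `N`-fixed duals are the `N`-equivariant maps.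
[cite: SilvermanAEC2009, Prop. III.8.1] [cite: MilneADT2006, I §3 (Weil pairing, `E[n]^D = E[n]`)] -/
theorem natCard_equivariantHom_torsion_mu_eq (n : ℕ) [NeZero n] (hn : IsPrimePow n)
    (N : Subgroup (Field.absoluteGaloisGroup F)) :
    Nat.card {h : HomCarrier (WeierstrassCurve.geomTorsion W n) (MuCarrier F n) //
        ∀ g : Field.absoluteGaloisGroup F, g ∈ N → ∀ m,
          mu F n g (h m) = h (GaloisRep.restrictField F (W.torsionGaloisModule n) g m)} =
      Nat.card {T : WeierstrassCurve.geomTorsion W n //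
        ∀ g : Field.absoluteGaloisGroup F, g ∈ N → GaloisRep.restrictField F (W.torsionGaloisModule n) g T = T} := by
  obtain ⟨p, k, hp, hk, hpk⟩ := hn
  haveI : Fact p.Prime := ⟨Nat.prime_iff.mpr hp⟩
  have h2 : 2 ≤ n := by
    rw [← hpk]
    calc 2 ≤ p := (Fact.out : p.Prime).two_le
      _ = p ^ 1 := (pow_one p).symm
      _ ≤ p ^ k := Nat.pow_le_pow_right (Fact.out : p.Prime).pos hk
  haveI : PerfectField K := PerfectField.ofCharZero
  haveI : Finite (WeierstrassCurve.geomTorsion W n) := Literature.NumberTheory.EllipticCurves.finite_geomTorsion_of_neZero W n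
  obtain ⟨e, hμ, hadd₁, hadd₂, -, hnondeg, hgal⟩ :=
    WeierstrassCurve.exists_weilPairing_holds W n h2 (by exact_mod_cast NeZero.ne n)
  set ρ : ContinuousRep (Field.absoluteGaloisGroup F) ℤ (WeierstrassCurve.geomTorsion W n) :=
    GaloisRep.restrictField F (W.torsionGaloisModule n) with hρ
  have hcard := natCard_fixed_eq_of_iso (τ₁ := ρ) (τ₂ := ρ.homRep (mu F n))
    (Literature.NumberTheory.EllipticCurves.weilDualLocalIso W n e hμ hadd₁ hadd₂ F hgal hnondeg) N
  rw [hcard]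
  refine Nat.card_congr (Equiv.subtypeEquivRight fun h ↦ ?_)
  refine forall_congr' fun g ↦ forall_congr' fun hg ↦ ?_
  exact (ContinuousRep.homRep_apply_eq_self_iff ρ (mu F n) g h).symm

/-- **The local count for `E[p^k]`**: for an open normal `N ≤ Γ_F` (`F ⊇ K` `p`-adic) and `t ≥ #E[p^k]^N`:
`#(𝒪_F/p^{2k[Γ:N]}) ≤ #H¹(N, E[p^k]) ≤ t² · #(𝒪_F/p^{2k[Γ:N]})`, and `H¹(N, E[p^k])` is finite (§3 with §4's Weil count,
`#E[p^k] = p^{2k}`). [cite: MilneADT2006, I Thm. 2.8, Cor. 2.3] [cite: GreenbergVatsal2000, §2 Prop. (2.1) (local terms at `p`)] -/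
theorem natCard_H1_subgroup_torsion_bounds (p k : ℕ) [Fact p.Prime] (hk : 0 < k) (N : Subgroup (Field.absoluteGaloisGroup F))
    (hN : IsOpen (N : Set (Field.absoluteGaloisGroup F))) [N.Normal]
    (ρC : ContinuousRep (Field.absoluteGaloisGroup F) ℤ
      (Field.absoluteGaloisGroup F ⧸ N → WeierstrassCurve.geomTorsion W ((p ^ k : ℕ) : ℤ)))
    (hρC : ∀ (g : Field.absoluteGaloisGroup F) (φ : Field.absoluteGaloisGroup F ⧸ N → WeierstrassCurve.geomTorsion W ((p ^ k : ℕ) : ℤ))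
      (y : Field.absoluteGaloisGroup F ⧸ N),
        ρC g φ y = GaloisRep.restrictField F (W.torsionGaloisModule (p ^ k : ℕ)) g (φ (g⁻¹ • y)))
    {t : ℕ} (ht : Nat.card {T : WeierstrassCurve.geomTorsion W ((p ^ k : ℕ) : ℤ) //
      ∀ g : Field.absoluteGaloisGroup F, g ∈ N → GaloisRep.restrictField F (W.torsionGaloisModule (p ^ k : ℕ)) g T = T} ≤ t) :
    Finite (continuousCohomology 1 (subgroupRep (GaloisRep.restrictField F (W.torsionGaloisModule (p ^ k : ℕ))).toTopRep N)) ∧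
    Nat.card (𝒪[F] ⧸ Ideal.span {((p ^ (2 * k * Nat.card (Field.absoluteGaloisGroup F ⧸ N)) : ℕ) : 𝒪[F])}) ≤
      Nat.card (continuousCohomology 1 (subgroupRep (GaloisRep.restrictField F (W.torsionGaloisModule (p ^ k : ℕ))).toTopRep N)) ∧
    Nat.card (continuousCohomology 1 (subgroupRep (GaloisRep.restrictField F (W.torsionGaloisModule (p ^ k : ℕ))).toTopRep N)) ≤
      t ^ 2 * Nat.card (𝒪[F] ⧸ Ideal.span {((p ^ (2 * k * Nat.card (Field.absoluteGaloisGroup F ⧸ N)) : ℕ) : 𝒪[F])}) := by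
  haveI : NeZero (p ^ k) := ⟨pow_ne_zero k (Fact.out : p.Prime).ne_zero⟩
  haveI : Finite (WeierstrassCurve.geomTorsion W ((p ^ k : ℕ) : ℤ)) :=
    Literature.NumberTheory.EllipticCurves.finite_geomTorsion_of_neZero W (p ^ k)
  have hM : ∀ T : WeierstrassCurve.geomTorsion W ((p ^ k : ℕ) : ℤ), p ^ k • T = 0 := fun T ↦
    AddSubgroup.torsionBy.nsmul T
  have hMn : Nat.card (WeierstrassCurve.geomTorsion W ((p ^ k : ℕ) : ℤ)) = p ^ (2 * k) := by
    rw [WeierstrassCurve.natCard_geomTorsion W ((p ^ k : ℕ) : ℤ) (by exact_mod_cast NeZero.ne (p ^ k)), Int.natAbs_natCast,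
      ← pow_mul, mul_comm]
  obtain ⟨hfin, hlow, hup⟩ := natCard_H1_subgroup_bounds F (GaloisRep.restrictField F (W.torsionGaloisModule (p ^ k : ℕ)))
    hM N hN ρC hρC
  rw [hMn, ← pow_mul] at hlow hup
  refine ⟨hfin, hlow, hup.trans ?_⟩
  rw [natCard_equivariantHom_torsion_mu_eq W F (p ^ k) ⟨p, k, Nat.prime_iff.mp Fact.out, hk, rfl⟩ N, sq]
  exact Nat.mul_le_mul_right _ (Nat.mul_le_mul ht ht)

end Weil

end Summit.BirchSwinnertonDyer.BirchSwinnertonDyer.Theorems.UniversalToricDescentLocalShapiroCount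

end
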